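import Literature.Geometry.Riemannian.RicciFlowMaximalExistence
import Literature.Geometry.Riemannian.RicciFlowShortTimeProofs
import HarnessLib

/-!
# Ricci flow: existence on a maximal time interval (Hamilton 1982, Thm. 14.1) — the discharge
(topic `Geometry/Riemannian`)

`ricciFlow_maximal_existence_holds` proves the named fact
`Literature.Geometry.Riemannian.ricciFlow_maximal_existence` (`RicciFlowMaximal.lean`): on a
closed manifold every smooth Riemannian metric `g₀` is the initial value of a Ricci flow which
either exists for all `t ≥ 0` or is maximal on some `[0, T)`, `0 < T < ∞`.

The proof follows Hamilton's own one-sentence argument (Hamilton 1982, p. 296: "Since we already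
know short time existence … we can take the maximum time interval `0 ≤ t < T` on which the
solution exists"; likewise Topping 2006, p. 46): it combines

* `ricciFlow_maximal_existence_of_shortTime_existence` (`RicciFlowMaximalExistence.lean`) — the
  Zorn's-lemma passage from short-time existence to a maximal solution (partial flows ordered by
  extension; chains glue), which needs no uniqueness; with
* `ricciFlow_shortTime_existence_holds` (`RicciFlowShortTimeProofs.lean`) — Hamilton's short-time
  existence theorem (Hamilton 1982, Thm. 4.2), proved there by DeTurck's trick from short-time
  existence for quasilinear strictly parabolic systems.

(This file is a sibling of `RicciFlowMaximal.lean` / `RicciFlowMaximalExistence.lean`; the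
discharge is kept out of those files so that their many importers do not acquire the parabolic
PDE library as a dependency.)

## References

* R. S. Hamilton, *Three-manifolds with positive Ricci curvature*, J. Differential Geom. 17
  (1982), 255–306, §14, Thm. 14.1 (p. 296) and Thm. 4.2 (p. 262). [Hamilton1982]
* P. Topping, *Lectures on the Ricci flow*, LMS Lecture Note Series 325, CUP 2006, §5.2,
  Thm. 5.2.1 and p. 46. [Topping2006]
-/

universe u v w

namespace Literature.Geometry.Riemannian

/-- **Hamilton's maximal existence theorem for the Ricci flow** (existence half of Hamilton 1982,
Thm. 14.1): the named fact `ricciFlow_maximal_existence` holds — on a closed manifold, the Ricci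
flow starting at any smooth Riemannian metric exists either for all time or on a maximal interval
`[0, T)` with `0 < T < ∞`.
[cite: Hamilton1982, §14, Thm. 14.1 (p. 296)] [cite: Topping2006, §5.2, p. 46] -/
theorem ricciFlow_maximal_existence_holds : ricciFlow_maximal_existence.{u, v, w} :=
  ricciFlow_maximal_existence_of_shortTime_existence ricciFlow_shortTime_existence_holds

end Literature.Geometry.Riemannian
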